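import Literature.RepresentationTheory.Kovacevic2021.SU21CasimirVanishing
import HarnessLib

/-!
# Kovačević's `SU(2,1)`-modules: the principal-series data `V(c, 2t)` (§3 Theorem 3, existence half) —
# the cone of `K`-types with vertex `V_{1,2t}` and the coefficients (b85)–(b100), for every `c ∈ ℂ`, `t ∈ ℤ`

Topic `RepresentationTheory/Kovacevic2021`; namespace `Literature.RepresentationTheory.Kovacevic2021`.
Definitions with bodies and theorems; no named fact.

Verbatim [Kovacevic2021, §3 Thm 3; held text `paper:arxiv-1810.01752` chunk p0007]: "**Theorem 3.** For any
`c ∈ ℂ` and `t ∈ ℤ` there exist a `(𝔤,K)` module `V(c,2t)` such that `V(c,2t)|_K = V_{1,2t} ⊕ ⨁_{n>1} V_{nm}`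
and `a_{1,2t} d_{2,2t+3} = c − ½t`. This module can be reducible. Any other irreducible `(𝔤,K)` module `V` is a
submodule, quotient or subquotient of some `V(c,2t)`."  From its proof [chunk p0008]: the `K`-type reached from
the vertex `V_{1,2t}` by "`p` steps in the `α+β` direction and `q` steps in the `−β` direction" is
`V_{1+p+q, 2t+3p−3q}`, with (b75) `a_{1+p+q,2t+3p−3q} d_{2+p+q,2t+3p−3q+3} = ((p+1)/(p+q+2))(2c−(p+1)t−p(p+2))`,
(b80) `b_{…} c_{2+p+q,2t+3p−3q−3} = ((q+1)/(p+q+2))(2c+(q+1)t−q(q+2))`, and "Coefficients `a_{nm}`, `b_{nm}`,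
`c_{nm}` and `d_{nm}` can be defined by (b85)–(b100): `a_{1+p+q,2t+3p−3q} = 2c−(p+1)t−p(p+2)`,
`b_{1+p+q,2t+3p−3q} = 2c+(q+1)t−q(q+2)`, `c_{2+p+q,2t+3p−3q−3} = (q+1)/(p+q+2)`, `d_{2+p+q,2t+3p−3q+3} = (p+1)/(p+q+2)`.
One can check that (b30)–(b45) are satisfied. By Theorem 2, `(𝔤,K)` module `V(c,2t)` is well defined."

## What is constructed / proved

* `SU21Datum.PrincipalSeries.cone t` — the `K`-types `{(1+p+q, 2t+3p−3q) : p, q ≥ 0}` (the cone with vertex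
  `V_{1,2t}`; one `K`-type of each dimension‐`n` column position) with the lattice coordinates
  `pOf`, `qOf` and their calculus (`pOf_eq`, `qOf_eq`, neighbours);
* **`SU21Datum.principalSeries c t : SU21Datum`** — the datum `V(c,2t)` in the tree's `u`-normalisation
  (`A = a/n`, `B = b/n`, `C = c`, `D = d`, `n = 1+p+q`; see `SU21ModulesFromKTypes`):
  `A = (2c−(p+1)t−p(p+2))/n`, `B = (2c+(q+1)t−q(q+2))/n`, `C = q/n`, `D = p/n` at the `K`-type with coordinates
  `(p,q)` — i.e. (b85)–(b100) read at the SOURCE of each arrow — and **all six relations (b20)–(b45) of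
  [Kovacevic2021, Thm 2] PROVED** (the structure fields `rel20` … `rel45`), so that `SU21Datum.ρ` makes
  `V(c,2t) = (principalSeries c t).V` an honest `𝔤𝔩₃(ℂ)`-module for every `c`, `t`
  (`SU21ModulesFromKTypes`, the sufficiency half of Thm 2);
* the printed normalisation at the vertex, `A_{1,2t} D_{2,2t+3} = c − t/2` (`principalSeries_vertex_AD`), and the
  invariant products (b75)/(b80) (`principalSeries_AD`, `principalSeries_BC`);
* **the Casimir of `V(c,2t)` is the scalar `4c + 2t²/3`** (`casimir_principalSeries`, via
  `casimir_eq_smul_one` of `SU21CasimirCentral`), hence by Borel–Wallach II 3.1 (a) (`SU21CasimirVanishing`)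
  **`H^q(𝔤𝔩₃, 𝔨; V(c,2t)) = 0` for all `q` unless `c = −t²/6`** (`finrank_relCohomology_principalSeries_eq_zero`).

NOT here: the second half of Thm 3 (every irreducible `(𝔤,K)`-module is a subquotient of some `V(c,2t)`),
reducibility points / composition series (Remark 6), irreducibility and unitarity (Thm 4, Thm 5).

## References

* D. Kovačević, Acta Math. Spalatensia 1 (2021) 105–125, doi:10.32817/ams.1.1.9 (arXiv:1810.01752), §3 Thm 2,
  Thm 3 with (b75)–(b100), Remark 6. [Kovacevic2021]
* A. Borel, N. Wallach (2000), II Prop. 3.1 (a), Cor. 3.3. [BorelWallach2000]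
-/

noncomputable section

open Module
open Literature.Algebra.Lie Literature.Algebra.Lie.ChevalleyEilenberg

namespace Literature.RepresentationTheory.Kovacevic2021

-- Mathlib idiom (Mathlib/Algebra/Lie/OfAssociative.lean): bracket on `Matrix`/`Module.End` = commutator.
attribute [local instance 100] LieRing.ofAssociativeRing

namespace SU21Datum

namespace PrincipalSeries

/-! ### The cone of `K`-types and its lattice coordinates -/

/-- The `K`-types of `V(c,2t)`: `V_{1+p+q, 2t+3p−3q}`, `p, q ≥ 0` ("`p` steps in the `α+β` direction and `q` steps in
the `−β` direction" from the vertex `V_{1,2t}`). [cite: Kovacevic2021, §3 Thm 3 and its proof] -/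
def cone (t : ℤ) : Set (ℤ × ℤ) :=
  {x | ∃ p q : ℤ, 0 ≤ p ∧ 0 ≤ q ∧ x.1 = 1 + p + q ∧ x.2 = 2 * t + 3 * p - 3 * q}

/-- the coordinate `p` of the `K`-type `(n, m) = (1+p+q, 2t+3p−3q)`: `p = (n − 1 + (m − 2t)/3)/2`
[cite: Kovacevic2021, §3 proof of Thm 3] -/
def pOf (t n m : ℤ) : ℤ := (n - 1 + (m - 2 * t) / 3) / 2

/-- the coordinate `q` of the `K`-type `(n, m) = (1+p+q, 2t+3p−3q)`: `q = (n − 1 − (m − 2t)/3)/2`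
[cite: Kovacevic2021, §3 proof of Thm 3] -/
def qOf (t n m : ℤ) : ℤ := (n - 1 - (m - 2 * t) / 3) / 2

variable {t : ℤ}

/-- membership of the cone, unfolded [cite: Kovacevic2021, §3 Thm 3] -/
theorem mem_cone_iff {n m : ℤ} :
    (n, m) ∈ cone t ↔ ∃ p q : ℤ, 0 ≤ p ∧ 0 ≤ q ∧ n = 1 + p + q ∧ m = 2 * t + 3 * p - 3 * q := Iff.rfl

/-- the point with coordinates `(p, q)` lies in the cone [cite: Kovacevic2021, §3 Thm 3] -/
theorem mem_cone {p q : ℤ} (hp : 0 ≤ p) (hq : 0 ≤ q) {n m : ℤ} (hn : n = 1 + p + q)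
    (hm : m = 2 * t + 3 * p - 3 * q) : (n, m) ∈ cone t :=
  ⟨p, q, hp, hq, hn, hm⟩

/-- `pOf` recovers `p` [cite: Kovacevic2021, §3 proof of Thm 3] -/
theorem pOf_eq {p q n m : ℤ} (hn : n = 1 + p + q) (hm : m = 2 * t + 3 * p - 3 * q) : pOf t n m = p := by
  subst hn hm
  unfold pOf
  omega

/-- `qOf` recovers `q` [cite: Kovacevic2021, §3 proof of Thm 3] -/
theorem qOf_eq {p q n m : ℤ} (hn : n = 1 + p + q) (hm : m = 2 * t + 3 * p - 3 * q) : qOf t n m = q := by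
  subst hn hm
  unfold qOf
  omega

/-- the `K`-types of the cone have positive dimension [cite: Kovacevic2021, §3 Thm 3] -/
theorem one_le_of_mem_cone {n m : ℤ} (h : (n, m) ∈ cone t) : 1 ≤ n := by
  obtain ⟨p, q, hp, hq, hn, -⟩ := h
  omega

/-- below the edge `q = 0` there is no `K`-type: `(p+q, 2t+3p−3q+3) ∉ cone` when `q = 0`
[cite: Kovacevic2021, §3 proof of Thm 3 ("a cone")] -/
theorem not_mem_cone_of_q {p n m : ℤ} (hn : n = 1 + p + 0) (hm : m = 2 * t + 3 * p - 3 * 0) :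
    (n - 1, m + 3) ∉ cone t := by
  rintro ⟨p', q', hp', hq', h1, h2⟩
  simp only at h1 h2
  omega

/-- below the edge `p = 0` there is no `K`-type: `(p+q, 2t+3p−3q−3) ∉ cone` when `p = 0`
[cite: Kovacevic2021, §3 proof of Thm 3 ("a cone")] -/
theorem not_mem_cone_of_p {q n m : ℤ} (hn : n = 1 + 0 + q) (hm : m = 2 * t + 3 * 0 - 3 * q) :
    (n - 1, m - 3) ∉ cone t := by
  rintro ⟨p', q', hp', hq', h1, h2⟩
  simp only at h1 h2
  omega

/-! ### The coefficients (b85)–(b100) in the `u`-normalisation, read at the source `K`-type -/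

open Classical in
/-- `A_{n,m} = a_{nm}/n = (2c − (p+1)t − p(p+2))/n` on the cone, `0` off it. [cite: Kovacevic2021, §3 Thm 3 (b85)] -/
def coefA (c : ℂ) (t n m : ℤ) : ℂ :=
  if (n, m) ∈ cone t then (2 * c - ((pOf t n m : ℂ) + 1) * t - (pOf t n m : ℂ) * ((pOf t n m : ℂ) + 2)) / n else 0

open Classical in
/-- `B_{n,m} = b_{nm}/n = (2c + (q+1)t − q(q+2))/n` on the cone, `0` off it. [cite: Kovacevic2021, §3 Thm 3 (b90)] -/
def coefB (c : ℂ) (t n m : ℤ) : ℂ :=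
  if (n, m) ∈ cone t then (2 * c + ((qOf t n m : ℂ) + 1) * t - (qOf t n m : ℂ) * ((qOf t n m : ℂ) + 2)) / n else 0

open Classical in
/-- `C_{n,m} = c_{nm} = q/n` on the cone (so `0` on the edge `q = 0`), `0` off it. [cite: Kovacevic2021, §3 Thm 3 (b95)] -/
def coefC (t n m : ℤ) : ℂ := if (n, m) ∈ cone t then (qOf t n m : ℂ) / n else 0

open Classical in
/-- `D_{n,m} = d_{nm} = p/n` on the cone (so `0` on the edge `p = 0`), `0` off it. [cite: Kovacevic2021, §3 Thm 3 (b100)] -/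
def coefD (t n m : ℤ) : ℂ := if (n, m) ∈ cone t then (pOf t n m : ℂ) / n else 0

variable {c : ℂ}

/-- `A` at the `K`-type with coordinates `(p,q)` [cite: Kovacevic2021, §3 Thm 3 (b85)] -/
theorem coefA_eq {p q n m : ℤ} (hp : 0 ≤ p) (hq : 0 ≤ q) (hn : n = 1 + p + q) (hm : m = 2 * t + 3 * p - 3 * q) :
    coefA c t n m = (2 * c - ((p : ℂ) + 1) * t - (p : ℂ) * ((p : ℂ) + 2)) / (n : ℂ) := by
  rw [coefA, if_pos (mem_cone hp hq hn hm), pOf_eq hn hm]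

/-- `B` at the `K`-type with coordinates `(p,q)` [cite: Kovacevic2021, §3 Thm 3 (b90)] -/
theorem coefB_eq {p q n m : ℤ} (hp : 0 ≤ p) (hq : 0 ≤ q) (hn : n = 1 + p + q) (hm : m = 2 * t + 3 * p - 3 * q) :
    coefB c t n m = (2 * c + ((q : ℂ) + 1) * t - (q : ℂ) * ((q : ℂ) + 2)) / (n : ℂ) := by
  rw [coefB, if_pos (mem_cone hp hq hn hm), qOf_eq hn hm]

/-- `C` at the `K`-type with coordinates `(p,q)` [cite: Kovacevic2021, §3 Thm 3 (b95)] -/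
theorem coefC_eq {p q n m : ℤ} (hp : 0 ≤ p) (hq : 0 ≤ q) (hn : n = 1 + p + q) (hm : m = 2 * t + 3 * p - 3 * q) :
    coefC t n m = (q : ℂ) / (n : ℂ) := by
  rw [coefC, if_pos (mem_cone hp hq hn hm), qOf_eq hn hm]

/-- `D` at the `K`-type with coordinates `(p,q)` [cite: Kovacevic2021, §3 Thm 3 (b100)] -/
theorem coefD_eq {p q n m : ℤ} (hp : 0 ≤ p) (hq : 0 ≤ q) (hn : n = 1 + p + q) (hm : m = 2 * t + 3 * p - 3 * q) :
    coefD t n m = (p : ℂ) / (n : ℂ) := by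
  rw [coefD, if_pos (mem_cone hp hq hn hm), pOf_eq hn hm]

/-- off the cone all coefficients vanish [cite: Kovacevic2021, §3 Def 1] -/
theorem coef_eq_zero {n m : ℤ} (h : (n, m) ∉ cone t) :
    coefA c t n m = 0 ∧ coefB c t n m = 0 ∧ coefC t n m = 0 ∧ coefD t n m = 0 := by
  simp only [coefA, coefB, coefC, coefD, if_neg h, and_self]

/-- `D = 0` on the edge `p = 0` and below it: `coefD t (q, 2t − 3q + 3) = 0` for `q ≥ 0` (the point `(0, q−1)`, or
no point at all if `q = 0`) [cite: Kovacevic2021, §3 Thm 3 (b100)] -/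
theorem coefD_edge_eq_zero {q n m : ℤ} (hq : 0 ≤ q) (hn : n = 1 + 0 + q) (hm : m = 2 * t + 3 * 0 - 3 * q) :
    coefD t (n - 1) (m + 3) = 0 := by
  rcases eq_or_lt_of_le hq with rfl | hq1
  · have h : (n - 1, m + 3) ∉ cone t := fun h' => by have := one_le_of_mem_cone h'; omega
    exact (coef_eq_zero (c := 0) h).2.2.2
  · rw [coefD_eq (p := 0) (q := q - 1) le_rfl (by omega) (by omega) (by omega), Int.cast_zero, zero_div]

/-- `C = 0` on the edge `q = 0` and below it: `coefC t (p, 2t + 3p − 3) = 0` for `p ≥ 0`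
[cite: Kovacevic2021, §3 Thm 3 (b95)] -/
theorem coefC_edge_eq_zero {p n m : ℤ} (hp : 0 ≤ p) (hn : n = 1 + p + 0) (hm : m = 2 * t + 3 * p - 3 * 0) :
    coefC t (n - 1) (m - 3) = 0 := by
  rcases eq_or_lt_of_le hp with rfl | hp1
  · have h : (n - 1, m - 3) ∉ cone t := fun h' => by have := one_le_of_mem_cone h'; omega
    exact (coef_eq_zero (c := 0) h).2.2.1
  · rw [coefC_eq (p := p - 1) (q := 0) (by omega) le_rfl (by omega) (by omega), Int.cast_zero, zero_div]

/-- `1 + p + q ≠ 0` in `ℂ` for `p, q ≥ 0` [folklore] -/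
private theorem npq_ne_zero {p q : ℤ} (hp : 0 ≤ p) (hq : 0 ≤ q) : (1 + (p : ℂ) + q) ≠ 0 := by
  exact_mod_cast (show (1 + p + q : ℤ) ≠ 0 by omega)

/-- `1 + p + q + 1 ≠ 0` in `ℂ` for `p, q ≥ 0` [folklore] -/
private theorem npq1_ne_zero {p q : ℤ} (hp : 0 ≤ p) (hq : 0 ≤ q) : (1 + (p : ℂ) + q + 1) ≠ 0 := by
  exact_mod_cast (show (1 + p + q + 1 : ℤ) ≠ 0 by omega)

/-- `1 + p + q - 1 ≠ 0` in `ℂ` for `p, q ≥ 0` not both zero [folklore] -/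
private theorem npqm1_ne_zero {p q : ℤ} (hp : 0 ≤ p) (hq : 0 ≤ q) (h : p ≠ 0 ∨ q ≠ 0) :
    (1 + (p : ℂ) + q - 1) ≠ 0 := by
  exact_mod_cast (show (1 + p + q - 1 : ℤ) ≠ 0 by omega)

end PrincipalSeries

open PrincipalSeries

/-- **The principal-series datum `V(c, 2t)`** of [Kovačević, Thm 3] for `c ∈ ℂ`, `t ∈ ℤ`: `K`-types the cone
`{V_{1+p+q, 2t+3p−3q} : p, q ≥ 0}` with vertex `V_{1,2t}`, coefficients (b85)–(b100) in the `u`-normalisation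
(`A = (2c−(p+1)t−p(p+2))/n`, `B = (2c+(q+1)t−q(q+2))/n`, `C = q/n`, `D = p/n`), and ALL relations
(b20)–(b45) of Thm 2 verified — so `SU21Datum.ρ` makes `(principalSeries c t).V` a `𝔤𝔩₃(ℂ)`-module for every
`c`, `t`. [cite: Kovacevic2021, §3 Thm 3 with (b75)–(b100)] -/
def principalSeries (c : ℂ) (t : ℤ) : SU21Datum where
  S := cone t
  A := coefA c t
  B := coefB c t
  C := coefC t
  D := coefD t
  one_le_of_mem := fun h => one_le_of_mem_cone h
  A_eq_zero := fun h => (coef_eq_zero h).1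
  B_eq_zero := fun h => (coef_eq_zero (c := c) h).2.1
  C_eq_zero := fun h => (coef_eq_zero (c := c) h).2.2.1
  D_eq_zero := fun h => (coef_eq_zero (c := c) h).2.2.2
  rel20 := by
    intro n m h
    obtain ⟨p, q, hp, hq, hn, hm⟩ := mem_cone_iff.1 h
    rw [coefA_eq hp hq hn hm, coefD_eq (n := n + 1) (m := m + 3) (p := p + 1) (q := q) (by omega) hq (by omega)
      (by omega), coefB_eq hp hq hn hm, coefC_eq (n := n + 1) (m := m - 3) (p := p) (q := q + 1) hp (by omega)
      (by omega) (by omega), coefC_eq hp hq hn hm]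
    rcases eq_or_lt_of_le hq with rfl | hq1
    · -- on the edge `q = 0` the third term vanishes (`C = 0`)
      simp only [Int.cast_zero, zero_div, zero_mul, mul_zero, sub_zero]
      subst hn hm
      have h0 : (1 + (p : ℂ)) ≠ 0 := by exact_mod_cast (show (1 + p : ℤ) ≠ 0 by omega)
      have h1 : (1 + (p : ℂ) + 1) ≠ 0 := by exact_mod_cast (show (1 + p + 1 : ℤ) ≠ 0 by omega)
      push_cast
      simp only [add_zero, sub_zero, zero_add]
      field_simp
      ring
    · rw [coefB_eq (n := n - 1) (m := m + 3) (p := p) (q := q - 1) hp (by omega) (by omega) (by omega)]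
      have h0 := npq_ne_zero hp hq
      have h1 := npq1_ne_zero hp hq
      have h2 := npqm1_ne_zero hp hq (Or.inr (by omega))
      subst hn hm
      push_cast
      field_simp
      ring
  rel25 := by
    intro n m h
    obtain ⟨p, q, hp, hq, hn, hm⟩ := mem_cone_iff.1 h
    rw [coefA_eq hp hq hn hm, coefD_eq (n := n + 1) (m := m + 3) (p := p + 1) (q := q) (by omega) hq (by omega)
      (by omega), coefB_eq hp hq hn hm, coefC_eq (n := n + 1) (m := m - 3) (p := p) (q := q + 1) hp (by omega)
      (by omega) (by omega), coefD_eq hp hq hn hm]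
    rcases eq_or_lt_of_le hp with rfl | hp1
    · -- on the edge `p = 0` the third term vanishes (`D = 0`)
      simp only [Int.cast_zero, zero_div, zero_mul, mul_zero, add_zero]
      subst hn hm
      have h0 : (1 + (q : ℂ)) ≠ 0 := by exact_mod_cast (show (1 + q : ℤ) ≠ 0 by omega)
      have h1 : (1 + (q : ℂ) + 1) ≠ 0 := by exact_mod_cast (show (1 + q + 1 : ℤ) ≠ 0 by omega)
      push_cast
      simp only [add_zero, sub_zero, zero_add]
      field_simp
      ring
    · rw [coefA_eq (n := n - 1) (m := m - 3) (p := p - 1) (q := q) (by omega) hq (by omega) (by omega)]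
      have h0 := npq_ne_zero hp hq
      have h1 := npq1_ne_zero hp hq
      have h2 := npqm1_ne_zero hp hq (Or.inl (by omega))
      subst hn hm
      push_cast
      field_simp
      ring
  rel30 := by
    intro n m
    by_cases h : (n, m) ∈ cone t
    · obtain ⟨p, q, hp, hq, hn, hm⟩ := mem_cone_iff.1 h
      have h0 := npq_ne_zero hp hq
      have h1 := npq1_ne_zero hp hq
      rw [coefB_eq hp hq hn hm, coefA_eq (n := n + 1) (m := m - 3) (p := p) (q := q + 1) hp (by omega) (by omega)
        (by omega), coefA_eq hp hq hn hm, coefB_eq (n := n + 1) (m := m + 3) (p := p + 1) (q := q) (by omega) hq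
        (by omega) (by omega)]
      subst hn hm
      push_cast
      field_simp
    · rw [(coef_eq_zero h).1, (coef_eq_zero (c := c) h).2.1, zero_mul, zero_mul]
  rel35 := by
    intro n m
    by_cases h : (n, m) ∈ cone t
    · obtain ⟨p, q, hp, hq, hn, hm⟩ := mem_cone_iff.1 h
      rw [coefD_eq hp hq hn hm, coefC_eq hp hq hn hm]
      rcases eq_or_lt_of_le hp with rfl | hp1
      · rw [coefD_edge_eq_zero hq hn hm, Int.cast_zero, zero_div, zero_mul, mul_zero]
      · rcases eq_or_lt_of_le hq with rfl | hq1
        · rw [coefC_edge_eq_zero hp hn hm, Int.cast_zero, zero_div, zero_mul, mul_zero]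
        · rw [coefC_eq (n := n - 1) (m := m - 3) (p := p - 1) (q := q) (by omega) hq (by omega) (by omega),
            coefD_eq (n := n - 1) (m := m + 3) (p := p) (q := q - 1) hp (by omega) (by omega) (by omega)]
          ring
    · rw [(coef_eq_zero (c := c) h).2.2.1, (coef_eq_zero (c := c) h).2.2.2, zero_mul, zero_mul]
  rel40 := by
    intro n m
    by_cases h : (n, m) ∈ cone t
    · obtain ⟨p, q, hp, hq, hn, hm⟩ := mem_cone_iff.1 h
      rw [coefA_eq hp hq hn hm, coefC_eq (n := n + 1) (m := m + 3) (p := p + 1) (q := q) (by omega) hq (by omega)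
        (by omega), coefC_eq hp hq hn hm]
      rcases eq_or_lt_of_le hq with rfl | hq1
      · rw [Int.cast_zero, zero_div, zero_div, mul_zero, zero_mul, mul_zero, mul_zero]
      · rw [coefA_eq (n := n - 1) (m := m + 3) (p := p) (q := q - 1) hp (by omega) (by omega) (by omega)]
        have h0 := npq_ne_zero hp hq
        have h1 := npq1_ne_zero hp hq
        have h2 := npqm1_ne_zero hp hq (Or.inr (by omega))
        subst hn hm
        push_cast
        field_simp
    · rw [(coef_eq_zero h).1, (coef_eq_zero (c := c) h).2.2.1, zero_mul, zero_mul, mul_zero, mul_zero]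
  rel45 := by
    intro n m
    by_cases h : (n, m) ∈ cone t
    · obtain ⟨p, q, hp, hq, hn, hm⟩ := mem_cone_iff.1 h
      rw [coefB_eq hp hq hn hm, coefD_eq (n := n + 1) (m := m - 3) (p := p) (q := q + 1) hp (by omega) (by omega)
        (by omega), coefD_eq hp hq hn hm]
      rcases eq_or_lt_of_le hp with rfl | hp1
      · rw [Int.cast_zero, zero_div, zero_div, mul_zero, zero_mul, mul_zero, mul_zero]
      · rw [coefB_eq (n := n - 1) (m := m - 3) (p := p - 1) (q := q) (by omega) hq (by omega) (by omega)]
        have h0 := npq_ne_zero hp hq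
        have h1 := npq1_ne_zero hp hq
        have h2 := npqm1_ne_zero hp hq (Or.inl (by omega))
        subst hn hm
        push_cast
        field_simp
    · rw [(coef_eq_zero (c := c) h).2.1, (coef_eq_zero (c := c) h).2.2.2, zero_mul, zero_mul, mul_zero, mul_zero]

variable (c : ℂ) (t : ℤ)

/-- the `K`-types of `V(c,2t)` [cite: Kovacevic2021, §3 Thm 3] -/
@[simp] theorem principalSeries_S : (principalSeries c t).S = cone t := rfl

/-- `V_{n,m}` is a `K`-type of `V(c,2t)` iff `(n,m) = (1+p+q, 2t+3p−3q)` with `p, q ≥ 0`: the vertex `V_{1,2t}` and,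
for `n > 1`, the `n` weights `m = 2t + 3(n−1), 2t + 3(n−3), …, 2t − 3(n−1)`. [cite: Kovacevic2021, §3 Thm 3] -/
theorem mem_principalSeries_S_iff (n m : ℤ) :
    (n, m) ∈ (principalSeries c t).S ↔ ∃ p q : ℤ, 0 ≤ p ∧ 0 ≤ q ∧ n = 1 + p + q ∧ m = 2 * t + 3 * p - 3 * q :=
  Iff.rfl

/-- the vertex `V_{1,2t}` is a `K`-type [cite: Kovacevic2021, §3 Thm 3] -/
theorem vertex_mem : ((1 : ℤ), 2 * t) ∈ (principalSeries c t).S :=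
  mem_cone le_rfl le_rfl (by ring) (by ring)

/-- **The printed normalisation at the vertex**: `a_{1,2t} d_{2,2t+3} = c − ½t` (here `A = a/n` with `n = 1`).
[cite: Kovacevic2021, §3 Thm 3] -/
theorem principalSeries_vertex_AD :
    (principalSeries c t).A 1 (2 * t) * (principalSeries c t).D 2 (2 * t + 3) = c - (t : ℂ) / 2 := by
  show coefA c t 1 (2 * t) * coefD t 2 (2 * t + 3) = _
  rw [coefA_eq (p := 0) (q := 0) le_rfl le_rfl (by ring) (by ring),
    coefD_eq (p := 1) (q := 0) zero_le_one le_rfl (by ring) (by ring)]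
  push_cast
  ring

/-- **(b75)**: `A_{n,m} D_{n+1,m+3} = (p+1)(2c − (p+1)t − p(p+2)) / (n(n+1))` at the `K`-type `(p,q)` (the paper's
`a d' = ((p+1)/(n+1))(2c−(p+1)t−p(p+2))` divided by the normalisation factor `n`).
[cite: Kovacevic2021, §3 proof of Thm 3 (b75)] -/
theorem principalSeries_AD {p q : ℤ} (hp : 0 ≤ p) (hq : 0 ≤ q) :
    (principalSeries c t).A (1 + p + q) (2 * t + 3 * p - 3 * q) *
        (principalSeries c t).D (1 + p + q + 1) (2 * t + 3 * p - 3 * q + 3) =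
      ((p : ℂ) + 1) * (2 * c - ((p : ℂ) + 1) * t - (p : ℂ) * ((p : ℂ) + 2)) / ((1 + p + q) * (1 + p + q + 1)) := by
  show coefA c t _ _ * coefD t _ _ = _
  rw [coefA_eq hp hq rfl rfl, coefD_eq (p := p + 1) (q := q) (by omega) hq (by ring) (by ring)]
  have h0 := npq_ne_zero hp hq
  have h1 := npq1_ne_zero hp hq
  push_cast
  field_simp

/-- **(b80)**: `B_{n,m} C_{n+1,m−3} = (q+1)(2c + (q+1)t − q(q+2)) / (n(n+1))` at the `K`-type `(p,q)`.
[cite: Kovacevic2021, §3 proof of Thm 3 (b80)] -/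
theorem principalSeries_BC {p q : ℤ} (hp : 0 ≤ p) (hq : 0 ≤ q) :
    (principalSeries c t).B (1 + p + q) (2 * t + 3 * p - 3 * q) *
        (principalSeries c t).C (1 + p + q + 1) (2 * t + 3 * p - 3 * q - 3) =
      ((q : ℂ) + 1) * (2 * c + ((q : ℂ) + 1) * t - (q : ℂ) * ((q : ℂ) + 2)) / ((1 + p + q) * (1 + p + q + 1)) := by
  show coefB c t _ _ * coefC t _ _ = _
  rw [coefB_eq hp hq rfl rfl, coefC_eq (p := p) (q := q + 1) hp (by omega) (by ring) (by ring)]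
  have h0 := npq_ne_zero hp hq
  have h1 := npq1_ne_zero hp hq
  push_cast
  field_simp

/-! ### The Casimir of `V(c, 2t)` and the cohomological parabola `c = −t²/6` -/

/-- **The Casimir of `V(c,2t)` is the scalar `4c + 2t²/3`** (reduced eigenvalue
`(n−1)(n+3)/2 + m²/6 + 2n(AD' + BC')` of `SU21CasimirCentral`, constant on the cone).
[cite: Kovacevic2021, §3 Thm 2, Thm 3, Remark 3] -/
theorem casimir_principalSeries :
    (principalSeries c t).casimir = (4 * c + 2 * (t : ℂ) ^ 2 / 3) • (1 : Module.End ℂ (principalSeries c t).V) := by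
  refine casimir_eq_smul_one _ fun n m hS => ?_
  obtain ⟨p, q, hp, hq, hn, hm⟩ := mem_cone_iff.1 hS
  show ((n : ℂ) - 1) * ((n : ℂ) + 3) / 2 + (m : ℂ) ^ 2 / 6
      + 2 * (n : ℂ) * (coefA c t n m * coefD t (n + 1) (m + 3) + coefB c t n m * coefC t (n + 1) (m - 3)) = _
  rw [coefA_eq hp hq hn hm, coefD_eq (n := n + 1) (m := m + 3) (p := p + 1) (q := q) (by omega) hq (by omega)
    (by omega), coefB_eq hp hq hn hm, coefC_eq (n := n + 1) (m := m - 3) (p := p) (q := q + 1) hp (by omega)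
    (by omega) (by omega)]
  have h0 := npq_ne_zero hp hq
  have h1 := npq1_ne_zero hp hq
  subst hn hm
  push_cast
  field_simp
  ring

/-- **`V(c,2t)` has no `(𝔤, 𝔨)`-cohomology off the parabola `c = −t²/6`**: if `4c + 2t²/3 ≠ 0` then
`H^q(𝔤𝔩₃, 𝔨; V(c,2t)) = 0` for every `q` (Borel–Wallach II 3.1 (a) / Cor. 3.3 via `SU21CasimirVanishing`).
[cite: BorelWallach2000, II Prop. 3.1 (a), Cor. 3.3] [cite: Kovacevic2021, §3 Thm 3] -/
theorem finrank_relCohomology_principalSeries_eq_zero (hc : 4 * c + 2 * (t : ℂ) ^ 2 / 3 ≠ 0) (q : ℕ) :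
    finrank ℂ (relCohomology ℂ gl3 (principalSeries c t).V kSub q) = 0 :=
  (principalSeries c t).finrank_relCohomology_eq_zero_of_casimir_eq_smul hc (casimir_principalSeries c t) q

/-- Contrapositive: a `V(c,2t)` with some non-zero `H^q(𝔤𝔩₃, 𝔨; ·)` lies on the parabola `6c + t² = 0`
(e.g. the six cohomological modules sit in `V(−3/2, ±6)`, `V(−3/2, 0)`-type data).
[cite: BorelWallach2000, II Cor. 3.3, VI Thm 4.11 (1)] -/
theorem principalSeries_parabola_of_finrank_relCohomology_ne_zero {q : ℕ}
    (hq : finrank ℂ (relCohomology ℂ gl3 (principalSeries c t).V kSub q) ≠ 0) : 6 * c + (t : ℂ) ^ 2 = 0 := by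
  have h := (principalSeries c t).casimir_scalar_eq_zero_of_finrank_relCohomology_ne_zero
    (casimir_principalSeries c t) hq
  linear_combination (3 / 2 : ℂ) * h

end SU21Datum

end Literature.RepresentationTheory.Kovacevic2021
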